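import Mathlib.Topology.Connected.LocallyConnected
import Mathlib.Topology.Algebra.Module.LocallyConvex
import Mathlib.Analysis.Complex.Convex
import Mathlib.Analysis.Complex.ReImTopology
import Literature.Probability.RandomPlanarGeometry.RestrictionHulls
import HarnessLib

/-!
# Filling a bounded closed set of the upper half-plane into a hull ([LSW] §2, "Fillings")

Half-plane topology for the decomposition of the named fact `Literature.Probability.RandomPlanarGeometry.LawlerSchrammWerner2003` (file
`ConformalRestriction`; plan in `ConformalRestrictionProofs`), in the vocabulary of
`RestrictionHulls`, after

* G. F. Lawler, O. Schramm, W. Werner, *Conformal restriction: the chordal case*, J. Amer. Math.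
  Soc. **16** (2003) 917–955, arXiv:math/0209343 (**[LSW]**), §2 p. 8: "**Fillings.** If
  `A ⊂ ℍ̄` is closed, let `Fill_ℍ(A)` denote the set of all `z ∈ ℍ̄` such that any path from `z`
  to `∞` in `ℍ̄ ∪ {∞}` meets `A`. In other words, `Fill_ℍ(A)` is the union of `A` and all the
  bounded connected components of `ℍ̄ ∖ A`."

We work with the OPEN half-plane `ℍ` (Mathlib's `upperHalfPlaneSet`) and the tree's
`Loewner.unboundedComponent` (the union of the unbounded connected components; for `ℍ ∖ S`, `S`
bounded, it is THE unbounded component, `unboundedComponent_eq_connectedComponentIn`):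

* `Literature.hpFill S = closure (ℍ ∖ unboundedComponent (ℍ ∖ S))` — the hull generated by `S`: for
  `S` closed, `ℍ ∖ hpFill S` is the unbounded component of `ℍ ∖ S` (`diff_hpFill`), `hpFill S`
  is bounded when `S` is (`isBounded_hpFill`) and is the closure of its part in `ℍ`;
* `Literature.Probability.RandomPlanarGeometry.isBoundedHull_hpFill` — if moreover `S ∪ {Im ≤ 0}` is connected ("`S` is attached to the
  real line"), `hpFill S ∈ 𝒬`: the complement `ℂ ∖ V` of the unbounded component `V` is then
  connected and unbounded (it is `S ∪ {Im ≤ 0}` together with the closures of the bounded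
  components, each of which meets `S ∪ {Im ≤ 0}`), so `V` is simply connected by the classical
  criterion NAMED here as the fact `Literature.Probability.RandomPlanarGeometry.isSimplyConnected_of_isConnected_compl` (Conway,
  *Functions of One Complex Variable I*, Ch. VIII Thm. 2.2, (c) ⇒ (a));
* `Literature.Probability.RandomPlanarGeometry.disjoint_range_hpFill_iff` — a transient path `γ` from `0` in `ℍ ∪ {0}` (the SLE trace
  in the simple phase) avoids `hpFill S` iff it avoids `S` (`0 ∉ S`): `γ(0, ∞)` is connected and
  unbounded in `ℍ ∖ S`, hence lies in the unbounded component; in particular `0 ∉ hpFill S` as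
  soon as some such path avoids `S` (`zero_notMem_hpFill_of_disjoint`), and then
  `hpFill S ∈ 𝒬*` (`isStarHull_hpFill`).

This turns the avoidance probabilities `P[γ ∩ S = ∅]` of attached test sets `S` into avoidance
probabilities of `*`-hulls, to which [LSW] Thm. 6.1 (`sle_restriction_eightThirds`) applies.

Mathlib: `connectedComponentIn` (with `IsOpen.connectedComponentIn` in the locally connected
space `ℂ`), `IsPreconnected.subset_connectedComponentIn`, `isPreconnected_sUnion`,
`Convex.isPreconnected`, `isClopen_iff`.
-/

noncomputable section

open Set Filter Topology Metric Bornology Complex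
open UpperHalfPlane (upperHalfPlaneSet isOpen_upperHalfPlaneSet)
open scoped NNReal

namespace Literature.Probability.RandomPlanarGeometry

/-! ### Named fact: a region with connected unbounded complement is simply connected -/

/-- NAMED FACT — **a plane region whose complement is connected and unbounded is simply
connected** (Conway, *Functions of One Complex Variable I* (1978), Ch. VIII, Thm. 2.2: for an
open connected `G ⊆ ℂ`, "(c) `ℂ_∞ ∖ G` is connected" implies "(a) `G` is simply connected" and
"(i) `G` is homeomorphic to the unit disk"). If `ℂ ∖ G` is connected and unbounded, then
`ℂ_∞ ∖ G = (ℂ ∖ G) ∪ {∞}` is connected (`∞` lies in the closure of the unbounded connected set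
`ℂ ∖ G`), so (c) holds; (i) gives simple connectivity in Mathlib's sense (`IsSimplyConnected`:
the subtype is a simply connected space), the disk being convex. Stated without the Riemann
sphere. [cite: Conway1978, Ch. VIII Thm. 2.2 (c) ⇒ (a), (i)] -/
def isSimplyConnected_of_isConnected_compl : Prop :=
  ∀ {G : Set ℂ}, IsOpen G → IsConnected G → IsConnected Gᶜ → ¬ IsBounded Gᶜ →
    IsSimplyConnected G

/-! ### Vertical rays and the far part of the half-plane -/

section Rays

variable {S : Set ℂ} {R : ℝ} {z : ℂ}

/-- The closed vertical ray upwards from `z`. [folklore] -/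
def upRay (z : ℂ) : Set ℂ := (fun t : ℝ ↦ z + t * I) '' Ici 0

/-- `z` is on its ray. [folklore] -/
theorem self_mem_upRay (z : ℂ) : z ∈ upRay z := ⟨0, mem_Ici.2 le_rfl, by simp⟩

/-- Rays are connected. [folklore] -/
theorem isConnected_upRay (z : ℂ) : IsConnected (upRay z) :=
  isConnected_Ici.image _ (by fun_prop : Continuous fun t : ℝ ↦ z + t * I).continuousOn

/-- Points of the ray have the same real part and larger imaginary part and norm. [folklore] -/
theorem mem_upRay_iff {w : ℂ} : w ∈ upRay z ↔ w.re = z.re ∧ z.im ≤ w.im := by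
  constructor
  · rintro ⟨t, ht, rfl⟩
    simp only [mem_Ici] at ht
    constructor
    · simp
    · simp [ht]
  · rintro ⟨hre, him⟩
    refine ⟨w.im - z.im, sub_nonneg.2 him, ?_⟩
    apply Complex.ext <;> simp [hre]

/-- Along the ray the norm does not decrease (`|z + it|² = re² + (im + t)² ≥ |z|²` for
`im z ≥ 0`). [folklore] -/
theorem norm_le_of_mem_upRay (hz : 0 ≤ z.im) {w : ℂ} (hw : w ∈ upRay z) : ‖z‖ ≤ ‖w‖ := by
  obtain ⟨hre, him⟩ := mem_upRay_iff.1 hw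
  rw [Complex.norm_eq_sqrt_sq_add_sq, Complex.norm_eq_sqrt_sq_add_sq, hre]
  exact Real.sqrt_le_sqrt (by nlinarith [sq_nonneg (w.im - z.im)])

/-- Rays are unbounded. [folklore] -/
theorem not_isBounded_upRay (z : ℂ) : ¬ IsBounded (upRay z) := by
  intro h
  obtain ⟨C, hC⟩ := h.subset_closedBall z
  have hmem : z + ((|C| + 1 : ℝ) : ℂ) * I ∈ upRay z := ⟨|C| + 1, mem_Ici.2 (by positivity), rfl⟩
  have h1 := hC hmem
  rw [mem_closedBall, dist_eq_norm, add_sub_cancel_left, norm_mul, Complex.norm_I, mul_one,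
    Complex.norm_real, Real.norm_eq_abs, abs_of_pos (by positivity)] at h1
  linarith [le_abs_self C]

/-- The ray from a point of `ℍ` outside `closedBall 0 R ⊇ S` stays in `ℍ ∖ S`. [folklore] -/
theorem upRay_subset (hS : S ⊆ closedBall 0 R) (hz : z ∈ upperHalfPlaneSet) (hzR : R < ‖z‖) :
    upRay z ⊆ upperHalfPlaneSet \ S := by
  intro w hw
  have hz0 : 0 < z.im := hz
  obtain ⟨hre, him⟩ := mem_upRay_iff.1 hw
  refine ⟨show 0 < w.im from hz0.trans_le him, fun hwS ↦ ?_⟩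
  have h1 : ‖w‖ ≤ R := by simpa using hS hwS
  exact absurd (hzR.trans_le ((norm_le_of_mem_upRay hz0.le hw).trans h1)) (lt_irrefl _)

/-- Far points of `ℍ` lie in an unbounded component of `ℍ ∖ S` (`S ⊆ closedBall 0 R`). [folklore] -/
theorem mem_unboundedComponent_of_lt_norm (hS : S ⊆ closedBall 0 R) (hz : z ∈ upperHalfPlaneSet)
    (hzR : R < ‖z‖) : z ∈ Loewner.unboundedComponent (upperHalfPlaneSet \ S) := by
  refine ⟨upRay_subset hS hz hzR (self_mem_upRay z), fun hb ↦ not_isBounded_upRay z (hb.subset ?_)⟩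
  exact (isConnected_upRay z).isPreconnected.subset_connectedComponentIn (self_mem_upRay z)
    (upRay_subset hS hz hzR)

/-- Two far points of `ℍ` lie in the same component of `ℍ ∖ S`: go up the first ray to a
common height above `R`, across horizontally, and down the second ray. [folklore] -/
theorem mem_connectedComponentIn_of_lt_norm (hS : S ⊆ closedBall 0 R) {z w : ℂ}
    (hz : z ∈ upperHalfPlaneSet) (hzR : R < ‖z‖) (hw : w ∈ upperHalfPlaneSet) (hwR : R < ‖w‖) :
    w ∈ connectedComponentIn (upperHalfPlaneSet \ S) z := by
  have hz0 : 0 < z.im := hz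
  have hw0 : 0 < w.im := hw
  -- common height
  set M : ℝ := |R| + ‖z‖ + ‖w‖ + 1 with hM
  have hMz : z.im ≤ M := by
    have := Complex.abs_im_le_norm z
    rw [hM]; linarith [le_abs_self z.im, abs_nonneg R, norm_nonneg w]
  have hMw : w.im ≤ M := by
    have := Complex.abs_im_le_norm w
    rw [hM]; linarith [le_abs_self w.im, abs_nonneg R, norm_nonneg z]
  have hMR : R < M := by rw [hM]; linarith [le_abs_self R, norm_nonneg z, norm_nonneg w]
  -- the horizontal segment at height `M`
  set p : ℂ := ⟨z.re, M⟩ with hp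
  set q : ℂ := ⟨w.re, M⟩ with hq
  have hpz : p ∈ upRay z := mem_upRay_iff.2 ⟨rfl, hMz⟩
  have hqw : q ∈ upRay w := mem_upRay_iff.2 ⟨rfl, hMw⟩
  have hseg : segment ℝ p q ⊆ upperHalfPlaneSet \ S := by
    intro u hu
    have him : u.im = M := by
      obtain ⟨a, b, ha, hb, hab, rfl⟩ := hu
      simp only [Complex.add_im, Complex.smul_im, smul_eq_mul, hp, hq]
      rw [← add_mul, hab, one_mul]
    have hu0 : 0 < u.im := by rw [him]; exact hz0.trans_le hMz
    refine ⟨hu0, fun huS ↦ ?_⟩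
    have h1 : ‖u‖ ≤ R := by simpa using hS huS
    have h2 : M ≤ ‖u‖ := by
      rw [← him]
      exact (le_abs_self _).trans (Complex.abs_im_le_norm u)
    linarith
  -- the connected set ray ∪ segment ∪ ray
  have hT : IsPreconnected (upRay z ∪ segment ℝ p q ∪ upRay w) := by
    refine ((isConnected_upRay z).isPreconnected.union p hpz (left_mem_segment ℝ p q)
      (convex_segment p q).isPreconnected).union q (Or.inr (right_mem_segment ℝ p q)) hqw
      (isConnected_upRay w).isPreconnected
  have hTsub : upRay z ∪ segment ℝ p q ∪ upRay w ⊆ upperHalfPlaneSet \ S :=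
    union_subset (union_subset (upRay_subset hS hz hzR) hseg) (upRay_subset hS hw hwR)
  exact hT.subset_connectedComponentIn (Or.inl (Or.inl (self_mem_upRay z))) hTsub
    (Or.inr (self_mem_upRay w))

end Rays

/-! ### The unbounded component of `ℍ ∖ S` -/

section Component

variable {S : Set ℂ} {R : ℝ}

/-- **The unbounded component is a component**: for `S ⊆ closedBall 0 R` and any far point
`z₀ ∈ ℍ`, `unboundedComponent (ℍ ∖ S)` is the connected component of `z₀` in `ℍ ∖ S`. [folklore] -/
theorem unboundedComponent_eq_connectedComponentIn (hS : S ⊆ closedBall 0 R) {z₀ : ℂ}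
    (hz₀ : z₀ ∈ upperHalfPlaneSet) (hz₀R : R < ‖z₀‖) :
    Loewner.unboundedComponent (upperHalfPlaneSet \ S) =
      connectedComponentIn (upperHalfPlaneSet \ S) z₀ := by
  refine Subset.antisymm ?_ fun z hz ↦ ?_
  · rintro z ⟨hzU, hzb⟩
    -- the component of `z` is unbounded, hence contains a far point `w`
    obtain ⟨w, hwC, hwR⟩ : ∃ w ∈ connectedComponentIn (upperHalfPlaneSet \ S) z,
        max R 0 + 1 < ‖w‖ := by
      by_contra h
      push Not at h
      exact hzb (isBounded_closedBall.subset fun w hw ↦ mem_closedBall_zero_iff.2 (h w hw))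
    have hw : w ∈ upperHalfPlaneSet := (connectedComponentIn_subset _ _ hwC).1
    have hwR' : R < ‖w‖ := by linarith [le_max_left R 0]
    -- `z ~ w ~ z₀`
    have h1 : connectedComponentIn (upperHalfPlaneSet \ S) z =
        connectedComponentIn (upperHalfPlaneSet \ S) w := connectedComponentIn_eq hwC
    have h2 : w ∈ connectedComponentIn (upperHalfPlaneSet \ S) z₀ :=
      mem_connectedComponentIn_of_lt_norm hS hz₀ hz₀R hw hwR'
    rw [connectedComponentIn_eq h2, ← h1]
    exact mem_connectedComponentIn hzU
  · have h1 : connectedComponentIn (upperHalfPlaneSet \ S) z₀ =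
        connectedComponentIn (upperHalfPlaneSet \ S) z := connectedComponentIn_eq hz
    obtain ⟨-, hb⟩ := mem_unboundedComponent_of_lt_norm hS hz₀ hz₀R
    exact ⟨connectedComponentIn_subset _ _ hz, by rwa [← h1]⟩

/-- A far point on the imaginary axis. [folklore] -/
theorem farPoint_mem (R : ℝ) : ((|R| + 1 : ℝ) : ℂ) * I ∈ upperHalfPlaneSet ∧
    R < ‖((|R| + 1 : ℝ) : ℂ) * I‖ := by
  constructor
  · show 0 < (((|R| + 1 : ℝ) : ℂ) * I).im
    simp; positivity
  · rw [norm_mul, Complex.norm_I, mul_one, Complex.norm_real, Real.norm_eq_abs,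
      abs_of_pos (by positivity)]
    linarith [le_abs_self R]

/-- The unbounded component of `ℍ ∖ S` is connected (`S` bounded). [folklore] -/
theorem isConnected_unboundedComponent (hS : IsBounded S) :
    IsConnected (Loewner.unboundedComponent (upperHalfPlaneSet \ S)) := by
  obtain ⟨R, hR⟩ := hS.subset_closedBall 0
  obtain ⟨h1, h2⟩ := farPoint_mem R
  rw [unboundedComponent_eq_connectedComponentIn hR h1 h2, isConnected_connectedComponentIn_iff]
  exact (mem_unboundedComponent_of_lt_norm hR h1 h2).1

/-- The unbounded component of `ℍ ∖ S` is open (`S` closed; components of open sets of the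
locally connected space `ℂ` are open). [folklore] -/
theorem isOpen_unboundedComponent (hS : IsClosed S) (hSb : IsBounded S) :
    IsOpen (Loewner.unboundedComponent (upperHalfPlaneSet \ S)) := by
  obtain ⟨R, hR⟩ := hSb.subset_closedBall 0
  obtain ⟨h1, h2⟩ := farPoint_mem R
  rw [unboundedComponent_eq_connectedComponentIn hR h1 h2]
  exact (isOpen_upperHalfPlaneSet.sdiff hS).connectedComponentIn

/-- Far points of `ℍ` are in the unbounded component. [folklore] -/
theorem diff_closedBall_subset_unboundedComponent (hS : S ⊆ closedBall 0 R) :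
    upperHalfPlaneSet \ closedBall 0 R ⊆ Loewner.unboundedComponent (upperHalfPlaneSet \ S) := by
  rintro z ⟨hz, hzR⟩
  rw [mem_closedBall, dist_zero_right, not_le] at hzR
  exact mem_unboundedComponent_of_lt_norm hS hz hzR

/-- A connected unbounded subset of `ℍ ∖ S` lies in the unbounded component. [folklore] -/
theorem subset_unboundedComponent_of_isPreconnected {T : Set ℂ} (hT : IsPreconnected T)
    (hTsub : T ⊆ upperHalfPlaneSet \ S) (hTb : ¬ IsBounded T) :
    T ⊆ Loewner.unboundedComponent (upperHalfPlaneSet \ S) := fun _ hz ↦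
  ⟨hTsub hz, fun hb ↦ hTb (hb.subset (hT.subset_connectedComponentIn hz hTsub))⟩

end Component

/-! ### The fill -/

section Fill

variable {S : Set ℂ} {R : ℝ}

/-- **The half-plane fill of `S`** ([LSW] §2 p. 8, "Fillings", for the open half-plane): the
closure of the complement in `ℍ` of the unbounded component of `ℍ ∖ S`, i.e. `S ∩ ℍ` together
with the bounded components of `ℍ ∖ S`, closed up. For `S` closed, bounded and attached to `ℝ`
this is the bounded hull `A ∈ 𝒬` with `ℍ ∖ A =` the unbounded component of `ℍ ∖ S`
(`isBoundedHull_hpFill`). [cite: LawlerSchrammWerner2003Restriction, §2 p. 8 (Fillings)] -/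
def hpFill (S : Set ℂ) : Set ℂ :=
  closure (upperHalfPlaneSet \ Loewner.unboundedComponent (upperHalfPlaneSet \ S))

/-- The fill is closed. [folklore] -/
theorem isClosed_hpFill (S : Set ℂ) : IsClosed (hpFill S) := isClosed_closure

/-- The fill lies in the closed half-plane. [folklore] -/
theorem hpFill_subset_closure (S : Set ℂ) : hpFill S ⊆ closure upperHalfPlaneSet :=
  closure_mono sdiff_subset

/-- `S ∩ ℍ ⊆ hpFill S`. [folklore] -/
theorem inter_subset_hpFill (S : Set ℂ) : S ∩ upperHalfPlaneSet ⊆ hpFill S :=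
  fun _ hz ↦ subset_closure ⟨hz.2, fun h ↦ h.1.2 hz.1⟩

/-- **The part of the fill in `ℍ`** is the complement of the unbounded component (`S` closed and
bounded, so that this component is open). [folklore] -/
theorem hpFill_inter (hS : IsClosed S) (hSb : IsBounded S) :
    hpFill S ∩ upperHalfPlaneSet =
      upperHalfPlaneSet \ Loewner.unboundedComponent (upperHalfPlaneSet \ S) := by
  refine Subset.antisymm ?_ fun z hz ↦ ⟨subset_closure hz, hz.1⟩
  rintro z ⟨hzF, hz⟩
  refine ⟨hz, fun hzV ↦ ?_⟩
  -- an open neighbourhood (`V`) of `z` misses `ℍ ∖ V`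
  have hV := isOpen_unboundedComponent hS hSb
  rw [hpFill, mem_closure_iff_nhds] at hzF
  obtain ⟨w, hwV, hw⟩ := hzF _ (hV.mem_nhds hzV)
  exact hw.2 hwV

/-- **`ℍ ∖ hpFill S` is the unbounded component of `ℍ ∖ S`** (`S` closed and bounded). [folklore] -/
theorem diff_hpFill (hS : IsClosed S) (hSb : IsBounded S) :
    upperHalfPlaneSet \ hpFill S = Loewner.unboundedComponent (upperHalfPlaneSet \ S) := by
  ext z
  constructor
  · rintro ⟨hz, hzF⟩
    by_contra hzV
    exact hzF (subset_closure ⟨hz, hzV⟩)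
  · intro hzV
    refine ⟨hzV.1.1, fun hzF ↦ ?_⟩
    have : z ∈ hpFill S ∩ upperHalfPlaneSet := ⟨hzF, hzV.1.1⟩
    rw [hpFill_inter hS hSb] at this
    exact this.2 hzV

/-- The fill of a bounded set is bounded (far points of `ℍ` are in the unbounded component). [folklore] -/
theorem isBounded_hpFill (hSb : IsBounded S) : IsBounded (hpFill S) := by
  obtain ⟨R, hR⟩ := hSb.subset_closedBall 0
  refine (isBounded_closedBall (x := (0 : ℂ)) (r := R)).closure.subset (closure_mono ?_)
  rintro z ⟨hz, hzV⟩
  by_contra hzR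
  exact hzV (diff_closedBall_subset_unboundedComponent hR ⟨hz, hzR⟩)

/-- The fill is the closure of its part in `ℍ`. [folklore] -/
theorem closure_hpFill_inter (hS : IsClosed S) (hSb : IsBounded S) :
    closure (hpFill S ∩ upperHalfPlaneSet) = hpFill S := by
  rw [hpFill_inter hS hSb, hpFill]

/-- **The complement of the unbounded component is connected and unbounded** when `S ∪ {Im ≤ 0}`
is connected: it is `S ∪ {Im ≤ 0}` together with the closures of the bounded components of
`ℍ ∖ S`, and each such closure meets `S ∪ {Im ≤ 0}` (a bounded open set of the connected space
`ℂ` is not closed, and its new closure points are not in the open set `ℍ ∖ S`, of which the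
component is a clopen part). [folklore] -/
theorem isConnected_compl_unboundedComponent (hS : IsClosed S)
    (hconn : IsConnected (S ∪ {z : ℂ | z.im ≤ 0})) :
    IsConnected (Loewner.unboundedComponent (upperHalfPlaneSet \ S))ᶜ ∧
      ¬ IsBounded (Loewner.unboundedComponent (upperHalfPlaneSet \ S))ᶜ := by
  set V := Loewner.unboundedComponent (upperHalfPlaneSet \ S) with hVdef
  set T := S ∪ {z : ℂ | z.im ≤ 0} with hTdef
  have hTV : T ⊆ Vᶜ := by
    rintro z (hzS | hz) hzV
    · exact hzV.1.2 hzS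
    · exact absurd (show 0 < z.im from hzV.1.1) (not_lt.2 hz)
  -- closures of bounded components
  have key : ∀ z ∈ Vᶜ, z ∉ T →
      IsConnected (closure (connectedComponentIn (upperHalfPlaneSet \ S) z)) ∧
      closure (connectedComponentIn (upperHalfPlaneSet \ S) z) ⊆ Vᶜ ∧
      (closure (connectedComponentIn (upperHalfPlaneSet \ S) z) ∩ T).Nonempty := by
    intro z hzV hzT
    have hz : z ∈ upperHalfPlaneSet \ S := by
      simp only [hTdef, mem_union, mem_setOf_eq, not_or, not_le] at hzT
      exact ⟨hzT.2, hzT.1⟩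
    set W := connectedComponentIn (upperHalfPlaneSet \ S) z with hW
    have hWopen : IsOpen W := (isOpen_upperHalfPlaneSet.sdiff hS).connectedComponentIn
    have hWconn : IsConnected W := isConnected_connectedComponentIn_iff.2 hz
    have hWb : IsBounded W := by
      by_contra hb
      exact hzV ⟨hz, hb⟩
    -- `W ⊆ Vᶜ`: a component meeting `V` would be unbounded
    have hWV : W ⊆ Vᶜ := by
      intro w hw hwV
      have h1 : connectedComponentIn (upperHalfPlaneSet \ S) z =
          connectedComponentIn (upperHalfPlaneSet \ S) w := connectedComponentIn_eq hw
      exact hwV.2 (by rw [← h1]; exact hWb)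
    -- new closure points are in `T`
    have hfront : closure W \ W ⊆ T := by
      rintro p ⟨hpc, hpW⟩
      by_contra hpT
      have hp : p ∈ upperHalfPlaneSet \ S := by
        simp only [hTdef, mem_union, mem_setOf_eq, not_or, not_le] at hpT
        exact ⟨hpT.2, hpT.1⟩
      -- the component of `p` is an open neighbourhood of `p` meeting `W`, hence equals `W`
      have hPopen : IsOpen (connectedComponentIn (upperHalfPlaneSet \ S) p) :=
        (isOpen_upperHalfPlaneSet.sdiff hS).connectedComponentIn
      rw [mem_closure_iff_nhds] at hpc
      obtain ⟨w, hwW, hwP⟩ := hpc _ (hPopen.mem_nhds (mem_connectedComponentIn hp))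
      have h1 := connectedComponentIn_eq hwP   -- comp p = comp w
      have h2 := connectedComponentIn_eq hwW   -- comp z = comp w
      apply hpW
      change p ∈ connectedComponentIn (upperHalfPlaneSet \ S) z
      rw [h1, ← h2]
      exact mem_connectedComponentIn hp
    refine ⟨hWconn.closure, ?_, ?_⟩
    · intro p hp
      by_cases hpW : p ∈ W
      · exact hWV hpW
      · exact hTV (hfront ⟨hp, hpW⟩)
    · -- `closure W ≠ W` since `W` is bounded, open, nonempty and `ℂ` is connected
      have hne : (closure W \ W).Nonempty := by
        by_contra h
        rw [not_nonempty_iff_eq_empty, sdiff_eq_empty] at h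
        have hclosed : IsClosed W := closure_subset_iff_isClosed.1 h
        rcases isClopen_iff.1 ⟨hclosed, hWopen⟩ with h0 | huniv
        · exact absurd h0 hWconn.nonempty.ne_empty
        · rw [huniv] at hWb
          exact not_isBounded_upRay 0 (hWb.subset (subset_univ _))
      obtain ⟨p, hp⟩ := hne
      exact ⟨p, hp.1, hfront hp⟩
  -- `Vᶜ` as a union of connected sets containing `T`
  obtain ⟨t₀, ht₀⟩ := hconn.nonempty
  classical
  let K : ℂ → Set ℂ := fun z ↦
    T ∪ if z ∈ T then ∅ else closure (connectedComponentIn (upperHalfPlaneSet \ S) z)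
  have hK : ∀ z ∈ Vᶜ, IsPreconnected (K z) ∧ K z ⊆ Vᶜ ∧ t₀ ∈ K z ∧ z ∈ K z := by
    intro z hz
    by_cases hzT : z ∈ T
    · simp only [K, if_pos hzT, union_empty]
      exact ⟨hconn.isPreconnected, hTV, ht₀, hzT⟩
    · obtain ⟨h1, h2, h3⟩ := key z hz hzT
      simp only [K, if_neg hzT]
      refine ⟨hconn.isPreconnected.union' (by rwa [inter_comm]) h1.isPreconnected,
        union_subset hTV h2, Or.inl ht₀, Or.inr (subset_closure (mem_connectedComponentIn ?_))⟩
      simp only [hTdef, mem_union, mem_setOf_eq, not_or, not_le] at hzT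
      exact ⟨hzT.2, hzT.1⟩
  have hrepr : Vᶜ = ⋃ z : {z // z ∈ Vᶜ}, K z.1 := by
    refine Subset.antisymm (fun z hz ↦ mem_iUnion.2 ⟨⟨z, hz⟩, (hK z hz).2.2.2⟩) ?_
    exact iUnion_subset fun z ↦ (hK z.1 z.2).2.1
  refine ⟨?_, fun hb ↦ ?_⟩
  · refine ⟨⟨t₀, hTV ht₀⟩, ?_⟩
    rw [hrepr]
    refine isPreconnected_iUnion ⟨t₀, mem_iInter.2 fun z ↦ (hK z.1 z.2).2.2.1⟩
      fun z ↦ (hK z.1 z.2).1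
  · -- `T ⊇ {Im ≤ 0}` is unbounded
    have hray : ¬ IsBounded {z : ℂ | z.im ≤ 0} := by
      intro h
      obtain ⟨C, hC⟩ := h.subset_closedBall 0
      have hmem : (-(((|C| + 1 : ℝ) : ℂ) * I)) ∈ {z : ℂ | z.im ≤ 0} := by
        simp only [mem_setOf_eq, Complex.neg_im, Complex.mul_im, Complex.ofReal_re, Complex.I_im,
          mul_one, Complex.ofReal_im, Complex.I_re, mul_zero, add_zero, neg_nonpos]
        positivity
      have := hC hmem
      rw [mem_closedBall, dist_zero_right, norm_neg, norm_mul, Complex.norm_I, mul_one,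
        Complex.norm_real, Real.norm_eq_abs, abs_of_pos (by positivity)] at this
      linarith [le_abs_self C]
    exact hray (hb.subset (subset_union_right.trans hTV))

/-- **The fill of an attached bounded closed set is a bounded hull** (`hpFill S ∈ 𝒬`), given
the classical criterion `isSimplyConnected_of_isConnected_compl` (hypothesis `hsc`): `S` closed,
bounded, with `S ∪ {Im ≤ 0}` connected. [cite: LawlerSchrammWerner2003Restriction, §2 p. 8 (Fillings)] -/
theorem isBoundedHull_hpFill (hsc : isSimplyConnected_of_isConnected_compl) (hS : IsClosed S)
    (hSb : IsBounded S) (hconn : IsConnected (S ∪ {z : ℂ | z.im ≤ 0})) :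
    IsBoundedHull (hpFill S) := by
  refine ⟨isBounded_hpFill hSb, closure_hpFill_inter hS hSb, ?_⟩
  rw [diff_hpFill hS hSb]
  obtain ⟨h1, h2⟩ := isConnected_compl_unboundedComponent hS hconn
  exact hsc (isOpen_unboundedComponent hS hSb) (isConnected_unboundedComponent hSb) h1 h2

/-- **A transient path from `0` in `ℍ ∪ {0}` avoiding `S` shows `0 ∉ hpFill S`**: near `0` the
half-plane minus `S ∌ 0` is a connected neighbourhood meeting the path, which runs in the
unbounded component. [folklore] -/
theorem zero_notMem_hpFill_of_disjoint (hS : IsClosed S) {γ : ℝ≥0 → ℂ} (hγc : Continuous γ)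
    (h0 : γ 0 = 0) (hγ : ∀ t, 0 < t → 0 < (γ t).im)
    (htr : Tendsto (fun t ↦ ‖γ t‖) atTop atTop) (hdisj : Disjoint (range γ) S) :
    (0 : ℂ) ∉ hpFill S := by
  have h0S : (0 : ℂ) ∉ S := fun h ↦ Set.disjoint_left.1 hdisj ⟨0, h0⟩ h
  -- `γ(0, ∞)` lies in the unbounded component `V`
  have hsub : γ '' Ioi 0 ⊆ Loewner.unboundedComponent (upperHalfPlaneSet \ S) := by
    refine subset_unboundedComponent_of_isPreconnected
      ((isConnected_Ioi.image _ hγc.continuousOn).isPreconnected) ?_ ?_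
    · rintro _ ⟨t, ht, rfl⟩
      exact ⟨hγ t ht, fun h ↦ Set.disjoint_left.1 hdisj ⟨t, rfl⟩ h⟩
    · intro hb
      obtain ⟨C, hC⟩ := hb.subset_closedBall 0
      obtain ⟨t₀, ht₀⟩ := (htr.eventually_gt_atTop C).and (eventually_gt_atTop 0) |>.exists
      have := hC ⟨t₀, ht₀.2, rfl⟩
      rw [mem_closedBall, dist_zero_right] at this
      linarith [ht₀.1]
  -- a small ball around `0` missing `S`; its upper half is connected and meets `γ(0,∞)`
  obtain ⟨r, hr, hball⟩ := Metric.isOpen_iff.1 hS.isOpen_compl 0 h0S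
  set N := ball (0 : ℂ) r ∩ upperHalfPlaneSet with hN
  have hNconn : IsPreconnected N :=
    ((convex_ball (0 : ℂ) r).inter (convex_halfSpace_im_gt 0)).isPreconnected
  have hNsub : N ⊆ upperHalfPlaneSet \ S := fun w hw ↦ ⟨hw.2, hball hw.1⟩
  -- a point of `γ(0,∞)` in `N`
  obtain ⟨t₁, ht₁, ht₁N⟩ : ∃ t, 0 < t ∧ γ t ∈ ball (0 : ℂ) r := by
    have hc : ContinuousAt γ 0 := hγc.continuousAt
    have hev : ∀ᶠ t in 𝓝 (0 : ℝ≥0), γ t ∈ ball (0 : ℂ) r := by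
      apply hc
      rw [h0]
      exact ball_mem_nhds _ hr
    have hev₁ : ∀ᶠ t in 𝓝[>] (0 : ℝ≥0), γ t ∈ ball (0 : ℂ) r := nhdsWithin_le_nhds hev
    have hev' : ∀ᶠ t in 𝓝[>] (0 : ℝ≥0), γ t ∈ ball (0 : ℂ) r ∧ 0 < t :=
      hev₁.and eventually_mem_nhdsWithin
    obtain ⟨t, ht, ht'⟩ := hev'.exists
    exact ⟨t, ht', ht⟩
  have hγt₁ : γ t₁ ∈ Loewner.unboundedComponent (upperHalfPlaneSet \ S) := hsub ⟨t₁, ht₁, rfl⟩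
  have hNV : N ⊆ Loewner.unboundedComponent (upperHalfPlaneSet \ S) := by
    intro w hw
    have h1 := hNconn.subset_connectedComponentIn (show γ t₁ ∈ N from ⟨ht₁N, hγ t₁ ht₁⟩) hNsub
    refine ⟨hNsub hw, fun hb ↦ hγt₁.2 ?_⟩
    rw [connectedComponentIn_eq (h1 hw)]
    exact hb
  -- hence the ball misses `ℍ ∖ V`, and `0 ∉ closure (ℍ ∖ V)`
  intro h0F
  rw [hpFill, mem_closure_iff_nhds] at h0F
  obtain ⟨w, hwB, hw⟩ := h0F _ (ball_mem_nhds 0 hr)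
  exact hw.2 (hNV ⟨hwB, hw.1⟩)

/-- **A transient path from `0` in `ℍ ∪ {0}` avoids the fill of `S` iff it avoids `S`** (`S`
closed, `0 ∉ S`): the trace `γ(0, ∞)` is connected and unbounded in `ℍ ∖ S`, so it lies in the
unbounded component ([LSW] Def. 3.1 remark: for `K ∈ Ω`, `K ∩ A = ∅` only depends on the fill).
[folklore] -/
theorem disjoint_range_hpFill_iff (hS : IsClosed S) (hSb : IsBounded S) (h0S : (0 : ℂ) ∉ S)
    {γ : ℝ≥0 → ℂ} (hγc : Continuous γ) (h0 : γ 0 = 0) (hγ : ∀ t, 0 < t → 0 < (γ t).im)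
    (htr : Tendsto (fun t ↦ ‖γ t‖) atTop atTop) :
    Disjoint (range γ) (hpFill S) ↔ Disjoint (range γ) S := by
  constructor
  · intro h
    refine Set.disjoint_left.2 ?_
    rintro _ ⟨t, rfl⟩ htS
    rcases eq_or_ne t 0 with rfl | ht
    · exact h0S (h0 ▸ htS)
    · exact Set.disjoint_left.1 h ⟨t, rfl⟩
        (inter_subset_hpFill S ⟨htS, hγ t (pos_iff_ne_zero.2 ht)⟩)
  · intro h
    have h0F := zero_notMem_hpFill_of_disjoint hS hγc h0 hγ htr h
    refine Set.disjoint_left.2 ?_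
    rintro _ ⟨t, rfl⟩ htF
    rcases eq_or_ne t 0 with rfl | ht
    · exact h0F (h0 ▸ htF)
    · have hsub : γ '' Ioi 0 ⊆ Loewner.unboundedComponent (upperHalfPlaneSet \ S) := by
        refine subset_unboundedComponent_of_isPreconnected
          ((isConnected_Ioi.image _ hγc.continuousOn).isPreconnected) ?_ ?_
        · rintro _ ⟨s, hs, rfl⟩
          exact ⟨hγ s hs, fun h' ↦ Set.disjoint_left.1 h ⟨s, rfl⟩ h'⟩
        · intro hb
          obtain ⟨C, hC⟩ := hb.subset_closedBall 0
          obtain ⟨t₀, ht₀⟩ := (htr.eventually_gt_atTop C).and (eventually_gt_atTop 0) |>.exists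
          have := hC ⟨t₀, ht₀.2, rfl⟩
          rw [mem_closedBall, dist_zero_right] at this
          linarith [ht₀.1]
      have hV : γ t ∈ Loewner.unboundedComponent (upperHalfPlaneSet \ S) :=
        hsub ⟨t, pos_iff_ne_zero.2 ht, rfl⟩
      rw [← diff_hpFill hS hSb] at hV
      exact hV.2 htF

/-- **The fill of an attached bounded closed set off `0` is a `*`-hull** (`hpFill S ∈ 𝒬*`),
e.g. as soon as some transient path from `0` in `ℍ ∪ {0}` avoids `S`
(`zero_notMem_hpFill_of_disjoint`). [cite: LawlerSchrammWerner2003Restriction, §2 p. 8 (Fillings, *-hulls)] -/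
theorem isStarHull_hpFill (hsc : isSimplyConnected_of_isConnected_compl) (hS : IsClosed S)
    (hSb : IsBounded S) (hconn : IsConnected (S ∪ {z : ℂ | z.im ≤ 0}))
    (h0 : (0 : ℂ) ∉ hpFill S) : IsStarHull (hpFill S) :=
  ⟨isBoundedHull_hpFill hsc hS hSb hconn, h0⟩

end Fill

end Literature.Probability.RandomPlanarGeometry

end
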